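import Literature.NumberTheory.Automorphic.ReductionTheoryGLnConjugation
import Literature.NumberTheory.Automorphic.TestFunctionGLLeftInvariance
import Literature.NumberTheory.Automorphic.IdeleClassGroupProofs
import Mathlib.Analysis.Matrix.Normed
import HarnessLib

/-!
# Block unipotents of `GL_n(𝔸_K)`: the archimedean matrix, conjugation by the Siegel cone, and
operator-norm bounds
(Garrett, *Modern Analysis of Automorphic Forms by Example* (2018), §7.3, Claim 7.3.6 and
Lemma 7.3.12, PDF pp. 335–336, 341–342)

Bricks for the basic estimate for cusp forms on a Siegel set
(`GLnCuspidalSpectrum.norm_smoothedForm_le_of_isSiegelSetGL`, Garrett Thm. 7.3.10), concerning the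
block unipotents `1 + X`, `X ∈ 𝔫_k(𝔸_K)` (`blockNilpotent`, `unipotentOfBlock` of
`GLnCuspidalSpectrum`). Everything here is proved:

* `archMatrixHom`, `blockArchMatrix X ∈ M_n(mixedSpace K)` — the archimedean components of the
  entries read in `K_∞ ≅ mixedSpace K = ℝ^{r₁} × ℂ^{r₂}` (Mathlib `ringEquiv_mixedSpace`), a ring /
  additive homomorphism; `blockArchMatrix X` has square zero.
* `unitOneAddBlock X = 1 + blockArchMatrix X ∈ GL_n(mixedSpace K)` and
  `unipotentOfBlock_eq_ofInfinite` — **a block unipotent with trivial finite part is the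
  archimedean element `(1 + X_∞, 1)`** (`GLn.ofInfinite`); `coe_conj_unitOneAddBlock` — its
  conjugates `c (1 + M) c⁻¹ = 1 + c M c⁻¹`.
* `blockConj b : 𝔫_k(𝔸_K) →+ 𝔫_k(𝔸_K)` — **conjugation by the Siegel cone**: for
  `a = posRealDiagonal b`, `a⁻¹ (1 + X) a = 1 + blockConj b X` with
  `(blockConj b X)_{ij} = (b_j / b_i) X_{ij}` (Garrett, proof of Claim 7.3.6: "the `ij`-th entry of
  `a_t⁻¹ u a_t` is `t_i⁻¹ t_j` times the `ij`-th entry of `u`"); the finite parts are unchanged and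
  the archimedean matrix is rescaled entrywise.
* `linfty_opNorm_le_mul_of_forall`, `norm_blockArchMatrix_blockConj_le` — **contraction in the
  cusp**: if `b_j / b_i ≤ ρ` on the block `i < k ≤ j` then
  `‖(blockConj b X)_∞‖ ≤ ρ ‖X_∞‖` for the `L^∞` operator norm (`Matrix.Norms.Operator`);
  `siegelCone_blockRatio_le` — on the Siegel cone `A_{T₀}(t)` the block ratios satisfy
  `b_j / b_i ≤ (b_k / b_{k-1}) · max(1, t⁻¹)^{2n}`, i.e. they are small when the `k`-th simple root
  `b_{k-1}/b_k` is large (Garrett, Lemma 7.3.12: "for `i' ≤ i < j'` the exponent of `α_i` … is `1`").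

## References

* P. Garrett, *Modern Analysis of Automorphic Forms by Example* (2018), §7.3, Claim 7.3.6
  (PDF pp. 335–336), Lemma 7.3.12 (PDF pp. 341–342) [Garrett2018].
-/

noncomputable section

open scoped MatrixGroups NNReal Classical
open NumberField NumberField.mixedEmbedding IsDedekindDomain Set
open _root_.Topology

namespace Literature.NumberTheory.Automorphic

/-! ### The archimedean matrix -/

section Arch

variable (n k : ℕ) (K : Type) [Field K] [NumberField K]

/-- **The archimedean matrix** of an adelic matrix: the archimedean components of the entries, read in
`mixedSpace K = ℝ^{r₁} × ℂ^{r₂}` through Mathlib's `ringEquiv_mixedSpace : K_∞ ≃+* mixedSpace K`;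
a ring homomorphism `M_n(𝔸_K) →+* M_n(mixedSpace K)`. [folklore] -/
def archMatrixHom : Matrix (Fin n) (Fin n) (AdeleRing (𝓞 K) K) →+* Matrix (Fin n) (Fin n) (mixedSpace K) :=
  (((InfiniteAdeleRing.ringEquiv_mixedSpace K).toRingHom).comp
    (RingHom.fst (InfiniteAdeleRing K) (FiniteAdeleRing (𝓞 K) K))).mapMatrix

variable {n K} in
/-- Entries of the archimedean matrix. [folklore] -/
@[simp]
theorem archMatrixHom_apply (M : Matrix (Fin n) (Fin n) (AdeleRing (𝓞 K) K)) (i j : Fin n) :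
    archMatrixHom n K M i j = InfiniteAdeleRing.ringEquiv_mixedSpace K ((M i j).1) :=
  rfl

/-- **The archimedean matrix of a block-nilpotent adelic matrix**, an additive homomorphism
`𝔫_k(𝔸_K) →+ M_n(mixedSpace K)`. [folklore] -/
def blockArchMatrix : blockNilpotent n k (AdeleRing (𝓞 K) K) →+ Matrix (Fin n) (Fin n) (mixedSpace K) :=
  (archMatrixHom n K).toAddMonoidHom.comp (blockNilpotent n k (AdeleRing (𝓞 K) K)).subtype

variable {n k K}

/-- Entries of the archimedean matrix of `X ∈ 𝔫_k(𝔸_K)`. [folklore] -/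
@[simp]
theorem blockArchMatrix_apply (X : blockNilpotent n k (AdeleRing (𝓞 K) K)) (i j : Fin n) :
    blockArchMatrix n k K X i j =
      InfiniteAdeleRing.ringEquiv_mixedSpace K
        ((((X : Matrix (Fin n) (Fin n) (AdeleRing (𝓞 K) K)) i j).1)) :=
  rfl

/-- `blockArchMatrix X = archMatrixHom X` (definitional). [folklore] -/
theorem blockArchMatrix_eq (X : blockNilpotent n k (AdeleRing (𝓞 K) K)) :
    blockArchMatrix n k K X = archMatrixHom n K (X : Matrix (Fin n) (Fin n) (AdeleRing (𝓞 K) K)) :=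
  rfl

/-- **The archimedean matrix of a block-nilpotent matrix has square zero** (`𝔫_k² = 0`,
`blockNilpotent_mul_self`, and `archMatrixHom` is multiplicative). [folklore] -/
theorem blockArchMatrix_mul_self (X : blockNilpotent n k (AdeleRing (𝓞 K) K)) :
    blockArchMatrix n k K X * blockArchMatrix n k K X = 0 := by
  rw [blockArchMatrix_eq, ← map_mul, blockNilpotent_mul_self X.2 X.2, map_zero]

/-- Off the block the archimedean matrix vanishes. [folklore] -/
theorem blockArchMatrix_apply_eq_zero {X : blockNilpotent n k (AdeleRing (𝓞 K) K)} {i j : Fin n}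
    (h : ¬((i : ℕ) < k ∧ k ≤ (j : ℕ))) : blockArchMatrix n k K X i j = 0 := by
  rw [blockArchMatrix_apply, apply_eq_zero_of_mem_blockNilpotent X.2 h]
  exact map_zero _

/-- The archimedean matrix depends continuously on `X`. [folklore] -/
theorem continuous_blockArchMatrix : Continuous (blockArchMatrix n k K) := by
  change Continuous fun X : blockNilpotent n k (AdeleRing (𝓞 K) K) =>
    (X : Matrix (Fin n) (Fin n) (AdeleRing (𝓞 K) K)).map
      (fun x => InfiniteAdeleRing.ringEquiv_mixedSpace K x.1)
  exact continuous_subtype_val.matrix_map ((continuous_ringEquiv_mixedSpace K).comp continuous_fst)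

/-- **The unit `1 + X_∞ ∈ GL_n(mixedSpace K)`** attached to `X ∈ 𝔫_k(𝔸_K)` (inverse `1 - X_∞`,
since `X_∞² = 0`). [folklore] -/
def unitOneAddBlock (X : blockNilpotent n k (AdeleRing (𝓞 K) K)) : GL (Fin n) (mixedSpace K) where
  val := 1 + blockArchMatrix n k K X
  inv := 1 - blockArchMatrix n k K X
  val_inv := by
    rw [add_mul, one_mul, mul_sub, mul_one, blockArchMatrix_mul_self, sub_zero, sub_add_cancel]
  inv_val := by
    rw [sub_mul, one_mul, mul_add, mul_one, blockArchMatrix_mul_self, add_zero, add_sub_cancel_right]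

/-- The underlying matrix of `unitOneAddBlock X` is `1 + X_∞`. [folklore] -/
@[simp]
theorem coe_unitOneAddBlock (X : blockNilpotent n k (AdeleRing (𝓞 K) K)) :
    (unitOneAddBlock X : Matrix (Fin n) (Fin n) (mixedSpace K)) = 1 + blockArchMatrix n k K X :=
  rfl

omit [NumberField K] in
/-- The inverse of `ringEquiv_mixedSpace` respects the entries of identity matrices. [folklore] -/
theorem ringEquiv_mixedSpace_symm_one_apply (i j : Fin n) :
    (InfiniteAdeleRing.ringEquiv_mixedSpace K).symm ((1 : Matrix (Fin n) (Fin n) (mixedSpace K)) i j) =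
      (1 : Matrix (Fin n) (Fin n) (InfiniteAdeleRing K)) i j := by
  rw [Matrix.one_apply, Matrix.one_apply]
  split_ifs
  · exact map_one _
  · exact map_zero _

/-- **A block unipotent with trivial finite part is the archimedean element `(1 + X_∞, 1)`**:
if all finite components of the entries of `X ∈ 𝔫_k(𝔸_K)` vanish, then
`1 + X = GLn.ofInfinite (1 + X_∞)` in `GL_n(𝔸_K)`. [folklore] -/
theorem unipotentOfBlock_eq_ofInfinite {X : blockNilpotent n k (AdeleRing (𝓞 K) K)}
    (hX : ∀ i j, (((X : Matrix (Fin n) (Fin n) (AdeleRing (𝓞 K) K)) i j).2) = 0) :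
    unipotentOfBlock n k (AdeleRing (𝓞 K) K) (Multiplicative.ofAdd X) =
      GLn.ofInfinite n K (unitOneAddBlock X) := by
  refine Units.ext (Matrix.ext fun i j => ?_)
  rw [coe_unipotentOfBlock, GLn.coe_ofInfinite_apply, coe_unitOneAddBlock, Matrix.add_apply,
    Matrix.add_apply, map_add, ringEquiv_mixedSpace_symm_one_apply, blockArchMatrix_apply,
    RingEquiv.symm_apply_apply]
  change ((1 : Matrix (Fin n) (Fin n) (AdeleRing (𝓞 K) K)) i j + (X : Matrix (Fin n) (Fin n) _) i j) = _
  refine Prod.ext ?_ ?_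
  · change ((1 : Matrix (Fin n) (Fin n) (AdeleRing (𝓞 K) K)) i j).1 +
      ((X : Matrix (Fin n) (Fin n) (AdeleRing (𝓞 K) K)) i j).1 = _
    rw [fst_one_apply]
  · change ((1 : Matrix (Fin n) (Fin n) (AdeleRing (𝓞 K) K)) i j).2 +
      ((X : Matrix (Fin n) (Fin n) (AdeleRing (𝓞 K) K)) i j).2 = _
    rw [hX i j, add_zero, snd_one_apply]

/-- **Conjugates of `1 + X_∞`**: `c (1 + M) c⁻¹ = 1 + c M c⁻¹` in `M_n(mixedSpace K)`. [folklore] -/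
theorem coe_conj_unitOneAddBlock (c : GL (Fin n) (mixedSpace K))
    (X : blockNilpotent n k (AdeleRing (𝓞 K) K)) :
    ((c * unitOneAddBlock X * c⁻¹ : GL (Fin n) (mixedSpace K)) : Matrix (Fin n) (Fin n) (mixedSpace K)) =
      1 + (c : Matrix (Fin n) (Fin n) (mixedSpace K)) * blockArchMatrix n k K X *
        ((c⁻¹ : GL (Fin n) (mixedSpace K)) : Matrix (Fin n) (Fin n) (mixedSpace K)) := by
  rw [Units.val_mul, Units.val_mul, coe_unitOneAddBlock, mul_add, mul_one, add_mul, Units.mul_inv]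

variable (n K) in
/-- Conjugation `M ↦ c M c⁻¹` by `c ∈ GL_n(mixedSpace K)` as an additive endomorphism of
`M_n(mixedSpace K)`. [folklore] -/
def matrixConj (c : GL (Fin n) (mixedSpace K)) :
    Matrix (Fin n) (Fin n) (mixedSpace K) →+ Matrix (Fin n) (Fin n) (mixedSpace K) where
  toFun M := (c : Matrix (Fin n) (Fin n) (mixedSpace K)) * M *
    ((c⁻¹ : GL (Fin n) (mixedSpace K)) : Matrix (Fin n) (Fin n) (mixedSpace K))
  map_zero' := by rw [mul_zero, zero_mul]
  map_add' M N := by rw [mul_add, add_mul]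

omit [NumberField K] in
/-- `matrixConj c M = c M c⁻¹` (definitional). [folklore] -/
@[simp]
theorem matrixConj_apply (c : GL (Fin n) (mixedSpace K)) (M : Matrix (Fin n) (Fin n) (mixedSpace K)) :
    matrixConj n K c M = (c : Matrix (Fin n) (Fin n) (mixedSpace K)) * M *
      ((c⁻¹ : GL (Fin n) (mixedSpace K)) : Matrix (Fin n) (Fin n) (mixedSpace K)) :=
  rfl

/-- The conjugate of `1 + X_∞`, through `matrixConj`. [folklore] -/
theorem coe_conj_unitOneAddBlock' (c : GL (Fin n) (mixedSpace K))
    (X : blockNilpotent n k (AdeleRing (𝓞 K) K)) :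
    ((c * unitOneAddBlock X * c⁻¹ : GL (Fin n) (mixedSpace K)) : Matrix (Fin n) (Fin n) (mixedSpace K)) =
      1 + matrixConj n K c (blockArchMatrix n k K X) := by
  rw [coe_conj_unitOneAddBlock, matrixConj_apply]

end Arch

/-! ### Conjugation by the Siegel cone -/

section Conj

variable {n k : ℕ} {K : Type} [Field K] [NumberField K]

/-- **Conjugation by the cone on `𝔫_k(𝔸_K)`**: `(blockConj b X)_{ij} = (b_j / b_i) · X_{ij}`, the real
scalar acting through the archimedean components (`realAdele`); an additive endomorphism. For
`a = posRealDiagonal b` this is `a⁻¹ (1 + X) a = 1 + blockConj b X`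
(`posRealDiagonal_inv_mul_unipotentOfBlock_mul`). (Garrett (2018), proof of Claim 7.3.6.)
[cite: Garrett2018, Claim 7.3.6 (PDF p. 336)] -/
def blockConj (b : Fin n → ℝ≥0ˣ) :
    blockNilpotent n k (AdeleRing (𝓞 K) K) →+ blockNilpotent n k (AdeleRing (𝓞 K) K) where
  toFun X := ⟨Matrix.of fun i j => realAdele K (((b j : ℝ≥0) : ℝ) / ((b i : ℝ≥0) : ℝ)) *
      (X : Matrix (Fin n) (Fin n) (AdeleRing (𝓞 K) K)) i j,
    fun i j hij => X.2 i j fun h0 => hij (by rw [Matrix.of_apply, h0, mul_zero])⟩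
  map_zero' := by
    refine Subtype.ext (Matrix.ext fun i j => ?_)
    change realAdele K _ * (0 : Matrix (Fin n) (Fin n) (AdeleRing (𝓞 K) K)) i j = 0
    rw [Matrix.zero_apply, mul_zero]
  map_add' X Y := by
    refine Subtype.ext (Matrix.ext fun i j => ?_)
    change realAdele K _ * ((X : Matrix (Fin n) (Fin n) (AdeleRing (𝓞 K) K)) i j +
      (Y : Matrix (Fin n) (Fin n) (AdeleRing (𝓞 K) K)) i j) =
      realAdele K _ * (X : Matrix (Fin n) (Fin n) (AdeleRing (𝓞 K) K)) i j +
        realAdele K _ * (Y : Matrix (Fin n) (Fin n) (AdeleRing (𝓞 K) K)) i j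
    rw [mul_add]

/-- Entries of `blockConj b X`. [folklore] -/
@[simp]
theorem blockConj_apply (b : Fin n → ℝ≥0ˣ) (X : blockNilpotent n k (AdeleRing (𝓞 K) K)) (i j : Fin n) :
    ((blockConj b X : blockNilpotent n k (AdeleRing (𝓞 K) K)) :
        Matrix (Fin n) (Fin n) (AdeleRing (𝓞 K) K)) i j =
      realAdele K (((b j : ℝ≥0) : ℝ) / ((b i : ℝ≥0) : ℝ)) *
        (X : Matrix (Fin n) (Fin n) (AdeleRing (𝓞 K) K)) i j :=
  rfl

/-- **`a⁻¹ (1 + X) a = 1 + blockConj b X`** for `a = posRealDiagonal b` (Garrett (2018), proof of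
Claim 7.3.6: conjugation by the cone multiplies the `ij`-entry by `t_i⁻¹ t_j`).
[cite: Garrett2018, Claim 7.3.6 (PDF p. 336)] -/
theorem posRealDiagonal_inv_mul_unipotentOfBlock_mul (b : Fin n → ℝ≥0ˣ)
    (X : blockNilpotent n k (AdeleRing (𝓞 K) K)) :
    (posRealDiagonal n K b)⁻¹ * unipotentOfBlock n k (AdeleRing (𝓞 K) K) (Multiplicative.ofAdd X) *
        posRealDiagonal n K b =
      unipotentOfBlock n k (AdeleRing (𝓞 K) K) (Multiplicative.ofAdd (blockConj b X)) := by
  refine Units.ext (Matrix.ext fun i j => ?_)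
  rw [coe_posRealDiagonal_inv_mul_mul_posRealDiagonal_apply, coe_unipotentOfBlock,
    coe_unipotentOfBlock, Matrix.add_apply, Matrix.add_apply]
  change _ = (1 : Matrix (Fin n) (Fin n) (AdeleRing (𝓞 K) K)) i j +
    realAdele K (((b j : ℝ≥0) : ℝ) / ((b i : ℝ≥0) : ℝ)) * (X : Matrix (Fin n) (Fin n) (AdeleRing (𝓞 K) K)) i j
  by_cases hij : i = j
  · subst hij
    have hb : ((b i : ℝ≥0) : ℝ) / ((b i : ℝ≥0) : ℝ) = 1 :=
      div_self (NNReal.coe_ne_zero.2 (b i).ne_zero)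
    rw [hb, realAdele_one, one_mul, one_mul]
    rfl
  · rw [Matrix.one_apply_ne hij, zero_add, zero_add]
    rfl

/-- Conjugation by the cone does not change the finite parts of the entries. [folklore] -/
theorem snd_blockConj_apply (b : Fin n → ℝ≥0ˣ) (X : blockNilpotent n k (AdeleRing (𝓞 K) K))
    (i j : Fin n) :
    (((blockConj b X : blockNilpotent n k (AdeleRing (𝓞 K) K)) :
        Matrix (Fin n) (Fin n) (AdeleRing (𝓞 K) K)) i j).2 =
      (((X : Matrix (Fin n) (Fin n) (AdeleRing (𝓞 K) K)) i j).2) := by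
  rw [blockConj_apply]
  change (realAdele K _).2 * _ = _
  rw [realAdele_snd, one_mul]

/-- The archimedean components of the entries of `blockConj b X` are rescaled:
`((blockConj b X)_{ij})_∞ = (b_j/b_i) · (X_{ij})_∞` in `K_∞`. [folklore] -/
theorem fst_blockConj_apply (b : Fin n → ℝ≥0ˣ) (X : blockNilpotent n k (AdeleRing (𝓞 K) K))
    (i j : Fin n) :
    (((blockConj b X : blockNilpotent n k (AdeleRing (𝓞 K) K)) :
        Matrix (Fin n) (Fin n) (AdeleRing (𝓞 K) K)) i j).1 =
      realToInfiniteAdele K (((b j : ℝ≥0) : ℝ) / ((b i : ℝ≥0) : ℝ)) *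
        (((X : Matrix (Fin n) (Fin n) (AdeleRing (𝓞 K) K)) i j).1) := by
  rw [blockConj_apply]
  rfl

/-- **The archimedean matrix of `blockConj b X` is rescaled entrywise**:
`(blockConj b X)_∞ i j = (b_j / b_i) • X_∞ i j`. [folklore] -/
theorem blockArchMatrix_blockConj_apply (b : Fin n → ℝ≥0ˣ) (X : blockNilpotent n k (AdeleRing (𝓞 K) K))
    (i j : Fin n) :
    blockArchMatrix n k K (blockConj b X) i j =
      ((((b j : ℝ≥0) : ℝ) / ((b i : ℝ≥0) : ℝ)) : ℝ) • blockArchMatrix n k K X i j := by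
  rw [blockArchMatrix_apply, fst_blockConj_apply, map_mul, ringEquiv_mixedSpace_realToInfiniteAdele,
    blockArchMatrix_apply, Algebra.smul_def]

/-! ### The operator-norm bounds -/

set_option backward.isDefEq.respectTransparency false in
open scoped Matrix.Norms.Operator in
/-- **Entrywise domination gives operator-norm domination** for the `L^∞` operator norm
`‖A‖ = max_i ∑_j ‖A i j‖`: if `‖A i j‖ ≤ ρ ‖B i j‖` for all `i, j` (`ρ ≥ 0`) then `‖A‖ ≤ ρ ‖B‖`.
[folklore] -/
theorem linfty_opNorm_le_mul_of_forall {α : Type*} [SeminormedAddCommGroup α] {m : Type*} [Fintype m]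
    {A B : Matrix m m α} {ρ : ℝ} (hρ : 0 ≤ ρ) (h : ∀ i j, ‖A i j‖ ≤ ρ * ‖B i j‖) :
    ‖A‖ ≤ ρ * ‖B‖ := by
  classical
  rw [Matrix.linfty_opNorm_def, Matrix.linfty_opNorm_def]
  set ρ' : ℝ≥0 := ⟨ρ, hρ⟩ with hρ'
  have hρρ : ρ = (ρ' : ℝ) := rfl
  rw [hρρ, ← NNReal.coe_mul, NNReal.coe_le_coe, NNReal.mul_finset_sup]
  refine Finset.sup_mono_fun fun i _ => ?_
  rw [Finset.mul_sum]
  refine Finset.sum_le_sum fun j _ => ?_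
  rw [← NNReal.coe_le_coe, NNReal.coe_mul, coe_nnnorm, coe_nnnorm]
  exact h i j

set_option backward.isDefEq.respectTransparency false in
open scoped Matrix.Norms.Operator in
/-- **Contraction of the archimedean matrix under the cone**: if `b_j / b_i ≤ ρ` for all block
positions `i < k ≤ j` (`ρ ≥ 0`), then `‖(blockConj b X)_∞‖ ≤ ρ ‖X_∞‖` (entries in the block are
rescaled by `b_j/b_i ∈ [0, ρ]`, entries off the block vanish). (Garrett (2018), Lemma 7.3.12.)
[cite: Garrett2018, Lemma 7.3.12 (PDF pp. 341–342)] -/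
theorem norm_blockArchMatrix_blockConj_le {b : Fin n → ℝ≥0ˣ} {ρ : ℝ} (hρ : 0 ≤ ρ)
    (hb : ∀ i j : Fin n, (i : ℕ) < k → k ≤ (j : ℕ) → ((b j : ℝ≥0) : ℝ) / ((b i : ℝ≥0) : ℝ) ≤ ρ)
    (X : blockNilpotent n k (AdeleRing (𝓞 K) K)) :
    ‖blockArchMatrix n k K (blockConj b X)‖ ≤ ρ * ‖blockArchMatrix n k K X‖ := by
  refine linfty_opNorm_le_mul_of_forall hρ fun i j => ?_
  by_cases hij : (i : ℕ) < k ∧ k ≤ (j : ℕ)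
  · rw [blockArchMatrix_blockConj_apply, _root_.norm_smul, Real.norm_of_nonneg (by positivity)]
    exact mul_le_mul_of_nonneg_right (hb i j hij.1 hij.2) (norm_nonneg _)
  · rw [blockArchMatrix_apply_eq_zero hij, blockArchMatrix_apply_eq_zero hij, norm_zero, mul_zero]

set_option backward.isDefEq.respectTransparency false in
open scoped Matrix.Norms.Operator in
/-- The operator norm of a conjugate: `‖c M c⁻¹‖ ≤ ‖c‖ ‖c⁻¹‖ ‖M‖`. [folklore] -/
theorem norm_matrixConj_le (c : GL (Fin n) (mixedSpace K)) (M : Matrix (Fin n) (Fin n) (mixedSpace K)) :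
    ‖matrixConj n K c M‖ ≤ ‖(c : Matrix (Fin n) (Fin n) (mixedSpace K))‖ *
      ‖((c⁻¹ : GL (Fin n) (mixedSpace K)) : Matrix (Fin n) (Fin n) (mixedSpace K))‖ * ‖M‖ := by
  rw [matrixConj_apply]
  calc ‖(c : Matrix (Fin n) (Fin n) (mixedSpace K)) * M *
        ((c⁻¹ : GL (Fin n) (mixedSpace K)) : Matrix (Fin n) (Fin n) (mixedSpace K))‖
      ≤ ‖(c : Matrix (Fin n) (Fin n) (mixedSpace K)) * M‖ *
          ‖((c⁻¹ : GL (Fin n) (mixedSpace K)) : Matrix (Fin n) (Fin n) (mixedSpace K))‖ := norm_mul_le _ _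
    _ ≤ ‖(c : Matrix (Fin n) (Fin n) (mixedSpace K))‖ * ‖M‖ *
          ‖((c⁻¹ : GL (Fin n) (mixedSpace K)) : Matrix (Fin n) (Fin n) (mixedSpace K))‖ :=
        mul_le_mul_of_nonneg_right (norm_mul_le _ _) (norm_nonneg _)
    _ = _ := by ring

/-! ### The block ratios on the Siegel cone -/

/-- **Block ratios on the Siegel cone.** If `t b_{l+1} ≤ b_l` for all `l` (`t > 0`), then for block
positions `i < k ≤ j` (`0 < k < n`, indices `κ = k`, `κ' = k - 1`),
`b_j / b_i ≤ (b_κ / b_κ') · (max 1 t⁻¹)^n · (max 1 t⁻¹)^n`: writing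
`b_j/b_i = (b_j/b_κ)(b_κ/b_κ')(b_κ'/b_i)` and bounding the outer factors by
`siegelRoot_div_le_max_pow`. So the block is contracted by the inverse of the `k`-th simple root
`b_{k-1}/b_k` (Garrett (2018), Lemma 7.3.12). [cite: Garrett2018, Lemma 7.3.12 (PDF pp. 341–342)] -/
theorem siegelCone_blockRatio_le {t : ℝ} (ht : 0 < t) {b : Fin n → ℝ≥0ˣ}
    (hroot : ∀ i j : Fin n, (j : ℕ) = (i : ℕ) + 1 → t * ((b j : ℝ≥0) : ℝ) ≤ ((b i : ℝ≥0) : ℝ))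
    {κ κ' : Fin n} (hκ : (κ : ℕ) = k) (hκ' : (κ' : ℕ) + 1 = k)
    {i j : Fin n} (hi : (i : ℕ) < k) (hj : k ≤ (j : ℕ)) :
    ((b j : ℝ≥0) : ℝ) / ((b i : ℝ≥0) : ℝ) ≤
      ((b κ : ℝ≥0) : ℝ) / ((b κ' : ℝ≥0) : ℝ) * (max 1 t⁻¹) ^ n * (max 1 t⁻¹) ^ n := by
  have hpos : ∀ l : Fin n, 0 < ((b l : ℝ≥0) : ℝ) := fun l =>
    NNReal.coe_pos.2 (pos_iff_ne_zero.2 (b l).ne_zero)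
  have h1 : ((b j : ℝ≥0) : ℝ) / ((b κ : ℝ≥0) : ℝ) ≤ (max 1 t⁻¹) ^ n :=
    siegelRoot_div_le_max_pow ht hroot (Fin.le_def.2 (by omega))
  have h2 : ((b κ' : ℝ≥0) : ℝ) / ((b i : ℝ≥0) : ℝ) ≤ (max 1 t⁻¹) ^ n :=
    siegelRoot_div_le_max_pow ht hroot (Fin.le_def.2 (by omega))
  have hsplit : ((b j : ℝ≥0) : ℝ) / ((b i : ℝ≥0) : ℝ) =
      (((b j : ℝ≥0) : ℝ) / ((b κ : ℝ≥0) : ℝ)) * (((b κ : ℝ≥0) : ℝ) / ((b κ' : ℝ≥0) : ℝ)) *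
        (((b κ' : ℝ≥0) : ℝ) / ((b i : ℝ≥0) : ℝ)) := by
    field_simp [(hpos κ).ne', (hpos κ').ne', (hpos i).ne']
  rw [hsplit]
  have hT : 0 ≤ (max 1 t⁻¹) ^ n := pow_nonneg (le_trans zero_le_one (le_max_left _ _)) n
  have hy0 : 0 ≤ ((b κ : ℝ≥0) : ℝ) / ((b κ' : ℝ≥0) : ℝ) := div_nonneg (hpos κ).le (hpos κ').le
  have hz0 : 0 ≤ ((b κ' : ℝ≥0) : ℝ) / ((b i : ℝ≥0) : ℝ) := div_nonneg (hpos κ').le (hpos i).le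
  calc (((b j : ℝ≥0) : ℝ) / ((b κ : ℝ≥0) : ℝ)) * (((b κ : ℝ≥0) : ℝ) / ((b κ' : ℝ≥0) : ℝ)) *
        (((b κ' : ℝ≥0) : ℝ) / ((b i : ℝ≥0) : ℝ))
      ≤ (max 1 t⁻¹) ^ n * (((b κ : ℝ≥0) : ℝ) / ((b κ' : ℝ≥0) : ℝ)) * (max 1 t⁻¹) ^ n :=
        mul_le_mul (mul_le_mul_of_nonneg_right h1 hy0) h2 hz0 (mul_nonneg hT hy0)
    _ = ((b κ : ℝ≥0) : ℝ) / ((b κ' : ℝ≥0) : ℝ) * (max 1 t⁻¹) ^ n * (max 1 t⁻¹) ^ n := by ring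

end Conj

end Literature.NumberTheory.Automorphic
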